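import Summits.Langlands.Langlands.Theses.IrreducibilityBySelfDuality
import Literature.NumberTheory.Automorphic.HarrisLanTaylorThorneCor627
import Summits.Langlands.Langlands.Theorems.IrreducibilityBySelfDualityHLTTCor627SplitOrUnramifiedOfThmA
import HarnessLib

/-!
# `IrreducibilityBySelfDuality.HLTTCor627SplitOrUnramified` BY NAME: conditional closure from
# Harris–Lan–Taylor–Thorne's Cor. 6.27 (item stmt-Langlands-15020, support, rank 8; `--supports`,
# conditional-result)

The route decl
`Summit.Langlands.Langlands.Theses.IrreducibilityBySelfDuality.HLTTCor627SplitOrUnramified`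
(child 1/4 of the crux `GaloisRepOfRegularAlgebraic`, route-choice re-route 2026-08-16) is,
binder for binder, the tree's named fact
`Literature.NumberTheory.Automorphic.HarrisLanTaylorThorne2016.corollary627_splitOrUnramified`
(Harris–Lan–Taylor–Thorne, *On the rigid cohomology of certain Shimura varieties*, Res. Math. Sci. 3
(2016), Cor. 6.27 (p. 225), in the consequence form consumed by the proof of Thm. 7.13 (p. 232):
for `K` CM with an imaginary quadratic subfield `F₀` in which `p` splits, `n > 1`, `π` cuspidal
regular algebraic on `GL_n(𝔸_K)`, `ı : ℚ̄_p ≃ ℂ`: for `N ≥ N₀` continuous semisimple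
`R_N : Γ_K → GL_{2n}(ℚ̄_p)` and `n`-element multisets `B_v` of non-zero `p`-adic numbers with, at every
`v ∣ q`, `q ≠ p` split in `F₀` or unramified in `K`, `π` unramified above `q`, `R_N` unramified and
`charpoly (R_N (Frob_v^arith)) = arithFrobPolyOfSatake ı q_v n α_v · ∏_{b ∈ B_v} (X - b q_v^{-2N})`).

This small module records that identity in the kernel (`route_iff_corollary627`, `Iff.rfl`: the
inlining neither loses nor gains strength) and states the closure AGAINST THE ROUTE DECL BY NAME
conditionally on the named fact (`route_of_corollary627`), so that the obligation graph records the item as closed CONDITIONALLY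
on `corollary627_splitOrUnramified`; the item closes unconditionally only with a discharge
`corollary627_splitOrUnramified_holds` (the rigid cohomology of the ordinary locus of the
`U(n,n)`-Shimura variety, §§4–6 of the paper — absent from the tree).  It imports the Theses file
and is therefore NOT to be imported by any module that closes an item of this route by name (kill
criterion (e): the gate's `_holds` link would cycle); the eventual closing module states the item
STRUCTURALLY (text verbatim, imports `Literature.NumberTheory.Automorphic.HarrisLanTaylorThorneCor627`
only) with proof `corollary627_splitOrUnramified_holds`.

References: M. Harris, K.-W. Lan, R. Taylor, J. Thorne, *On the rigid cohomology of certain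
Shimura varieties*, Res. Math. Sci. 3:37 (2016), §1 p. 11 (standing notation `F = F₀F⁺`, `p`
split in `F₀`), Cor. 6.27 (p. 225), proof of Thm. 7.13 (p. 232). [HarrisLanTaylorThorneRMS2016]
-/

set_option linter.dupNamespace false -- project-wide option (lakefile weak.linter.dupNamespace); `Summit.Langlands.Langlands` is the mandated namespace

namespace Summit.Langlands.Langlands.Theorems.HLTTCor627SplitOrUnramified

open Literature.NumberTheory.Automorphic

/-- The route decl `IrreducibilityBySelfDuality.HLTTCor627SplitOrUnramified` is, definitionally,
the named fact `HarrisLanTaylorThorne2016.corollary627_splitOrUnramified` (Harris–Lan–Taylor–Thorne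
2016, Cor. 6.27 in the consequence form of the proof of Thm. 7.13).
[cite: HarrisLanTaylorThorneRMS2016, Cor. 6.27 (p. 225); proof of Thm. 7.13 (p. 232)] -/
theorem route_iff_corollary627 :
    Summit.Langlands.Langlands.Theses.IrreducibilityBySelfDuality.HLTTCor627SplitOrUnramified ↔
      HarrisLanTaylorThorne2016.corollary627_splitOrUnramified :=
  Iff.rfl

/-- **Conditional closure by name** (`conditional-result`): Harris–Lan–Taylor–Thorne 2016,
Cor. 6.27 (the named fact `HarrisLanTaylorThorne2016.corollary627_splitOrUnramified`) gives the
route decl `IrreducibilityBySelfDuality.HLTTCor627SplitOrUnramified`.  The item closes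
unconditionally only with `corollary627_splitOrUnramified_holds`.
[cite: HarrisLanTaylorThorneRMS2016, Cor. 6.27 (p. 225)] -/
theorem route_of_corollary627 (h : HarrisLanTaylorThorne2016.corollary627_splitOrUnramified) :
    Summit.Langlands.Langlands.Theses.IrreducibilityBySelfDuality.HLTTCor627SplitOrUnramified :=
  h

/-- **The leaf is implied by the crux it feeds, by name** (calibration, appended 2026-08-16 by
the fourth prover seat): the route's crux `GaloisRepOfRegularAlgebraic` (lang.S27 — HLTT Thm. A
with Varma's local–global compatibility — verbatim) implies the route item
`HLTTCor627SplitOrUnramified`, through the Theses-free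
`corollary627_of_existsGaloisRep` (`R_N := r_{p,ı}(π) ⊞ (𝟙_n ⊗ ε_p^{-2N})`, `B_v := {1,…,1}`: the
shape of `R_{p,ı}(π, N)` in the proof of HLTT Thm. 7.13, p. 232, read backwards).  Together with
the landed glue `GaloisRepOfRegularAlgebraicOfLeaves` this makes the item equivalent to the crux
modulo the three other leaves: it is crux-strength formalization debt and cannot be
misstated-false.  Conditional (its hypothesis is an open crux); closes nothing.
[cite: HarrisLanTaylorThorneRMS2016, Thm. A; Cor. 6.27 (p. 225); proof of Thm. 7.13 (p. 232)] -/
theorem route_of_galoisRepOfRegularAlgebraic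
    (h : Summit.Langlands.Langlands.Theses.IrreducibilityBySelfDuality.GaloisRepOfRegularAlgebraic) :
    Summit.Langlands.Langlands.Theses.IrreducibilityBySelfDuality.HLTTCor627SplitOrUnramified :=
  corollary627_of_existsGaloisRep fun hcpt => h _ _ hcpt

end Summit.Langlands.Langlands.Theorems.HLTTCor627SplitOrUnramified
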